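import Literature.RepresentationTheory.IntertwiningMapEvalInjective        -- ★ p831571 (A-p06 (g24)): G2 `finite_and_finrank_intertwiningMap_le_of_eval_mem`
import Literature.RepresentationTheory.IntertwiningMapFiltrationTelescope   -- ★ p831104 (A-p06 (g24)): N4b `finrank_intertwiningMap_eq_add_sum_of_compl`
import HarnessLib

/-!
# `dim Hom_G(τ, σ) ≤ dim σ` for irreducible `τ`, and the «small levels» bound along a filtration with complements

Topic `RepresentationTheory`; namespace `Literature.RepresentationTheory`; THEOREMS ONLY (no `def`, no named fact, no instance, no notation, no `sorry`).
Cell `hodgecm-mathlib`, F0∕P3, T1a arch line: piece (β) «small levels» of the N3 plan of record (A-p14 (g23) 2026-08-31T18:59:57Z, step (v)) for the stub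
`stub_N3 : LevelBound₂₁` of the V19 pay-down line `Cruxes/H413/Lines/F0_T1a_V19KTypeGrowthPaydown.lean` (ED. 1 cdc6bbdbd5a1).

THE STATEMENTS ([KnappVogan1995, §I.3]).  `τ` irreducible on `W`, `σ` on a finite-dimensional `Q`: evaluation at any `w₀ ≠ 0` embeds `Hom_G(τ, σ)` into `Q`
(★ G2), so **`dim Hom_G(τ, σ) ≤ dim Q`** (`finite_and_finrank_intertwiningMap_le_finrank`).  Along a chain `F` of subrepresentations with complements `Q (m+1)`
(`F (m+1) = F m ⊔ Q (m+1)`, `F m ⊓ Q (m+1) = ⊥`) the telescope ★ N4b then gives the «SMALL LEVELS» bound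
**`dim Hom_G(τ, F 0) + Σ_{m<n} dim Hom_G(τ, Q (m+1)) = dim Hom_G(τ, F n) ≤ dim F n`** (`sum_finrank_intertwiningMap_le_finrank_of_compl`): the finitely many
levels below a threshold `n₀` contribute at most the constant `dim F n₀`, whatever `τ` is.
HONEST LABEL: closes no registered stub by itself.  HC_CM is proved only modulo the 2 remaining named inputs (hLiu418, h413) until rung 0 closes.

## References
* A. W. Knapp, D. A. Vogan, *Cohomological Induction and Unitary Representations* (1995), §I.3 [KnappVogan1995].
-/

set_option autoImplicit false

noncomputable section

namespace Literature.RepresentationTheory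

universe u v w w'

variable {k : Type u} [Field k] {G : Type v} [Group G]
  {W : Type w} [AddCommGroup W] [Module k W]

/-- **`dim Hom_G(τ, σ) ≤ dim Q`** for `τ` irreducible and `σ` on a finite-dimensional `Q` (evaluation at a non-zero vector is injective, ★ G2); in particular
`Hom_G(τ, σ)` is finite-dimensional. [cite: KnappVogan1995, §I.3] -/
theorem finite_and_finrank_intertwiningMap_le_finrank {Q : Type w'} [AddCommGroup Q] [Module k Q] [FiniteDimensional k Q]
    (τ : Representation k G W) [τ.IsIrreducible] (σ : Representation k G Q) :
    Module.Finite k (Representation.IntertwiningMap τ σ) ∧ Module.finrank k (Representation.IntertwiningMap τ σ) ≤ Module.finrank k Q := by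
  haveI : Nontrivial W := by
    have hbt : (⊥ : Subrepresentation τ) ≠ ⊤ := bot_ne_top
    have h' : (⊥ : Submodule k W) ≠ ⊤ := fun h => hbt (Subrepresentation.toSubmodule_injective (by exact h))
    exact (Submodule.nontrivial_iff k).mp ⟨⟨⊥, ⊤, h'⟩⟩
  obtain ⟨w₀, hw₀⟩ := exists_ne (0 : W)
  have h := finite_and_finrank_intertwiningMap_le_of_eval_mem τ σ hw₀ ⊤ fun _ => Submodule.mem_top
  rw [finrank_top] at h
  exact h

/-- **«SMALL LEVELS»**: along a chain of subrepresentations `F` of `R` (on `X`, in the universe of `W` as in ★ N4b) with complements `Q (m+1)`, for `τ` irreducible and `F n` finite-dimensional,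
`dim Hom_G(τ, F 0) + Σ_{m<n} dim Hom_G(τ, Q (m+1)) ≤ dim F n` (★ N4b telescope `=` `dim Hom_G(τ, F n)`, then `≤ dim F n`). [cite: KnappVogan1995, §I.3] -/
theorem sum_finrank_intertwiningMap_le_finrank_of_compl {X : Type w} [AddCommGroup X] [Module k X] {R : Representation k G X}
    (τ : Representation k G W) [τ.IsIrreducible] (F Q : ℕ → Subrepresentation R)
    (hsup : ∀ m, F (m + 1) = F m ⊔ Q (m + 1)) (hdisj : ∀ m, Disjoint (F m).toSubmodule (Q (m + 1)).toSubmodule)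
    [∀ m, Module.Finite k (Representation.IntertwiningMap τ (F m).toRepresentation)]
    [∀ m, Module.Finite k (Representation.IntertwiningMap τ (Q m).toRepresentation)] (n : ℕ) [FiniteDimensional k (F n).toSubmodule] :
    Module.finrank k (Representation.IntertwiningMap τ (F 0).toRepresentation) +
        ∑ m ∈ Finset.range n, Module.finrank k (Representation.IntertwiningMap τ (Q (m + 1)).toRepresentation) ≤
      Module.finrank k (F n).toSubmodule := by
  rw [← finrank_intertwiningMap_eq_add_sum_of_compl τ F Q hsup hdisj n]
  exact (finite_and_finrank_intertwiningMap_le_finrank τ (F n).toRepresentation).2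

end Literature.RepresentationTheory

end
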